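import Summits.CriticalPhenomena.PercolationContinuityZ3.Theorems.PercNearOneGluingNoHeavyLowerTailSahiE3HittingEvents
import Summits.CriticalPhenomena.PercolationContinuityZ3.Theorems.SahiInfiniteVolumeCylinderEvents
import Literature.Probability.LatticeModels.SahiE3Reflection
import Literature.Probability.LatticeModels.IsoradialPercolationProofs
import HarnessLib

/-!
# `NoHeavyLowerTail` (crux stmt-CriticalPhenomena-4575), Sahi programme P5: hitting events — the DECREASING form
# ("some coordinate of `S` absent") and the bond-percolation rows ("some edge of `F` open / closed") on ANY graph

Support file (seat `prim-l12-p5`, gen 6; `--supports stmt-CriticalPhenomena-4575`).  Proofs only; no definitions, no named facts,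
no sorries; standard axioms.  Corollaries of `SahiHitting.prodBernoulli_sahiE3_hit_nonneg` (Kahn's Conjecture 5 for three hitting
events `H_S = {ω | ∃ i ∈ S, i ∈ ω}`, any index type) by the two standard transports of the tree:

* REFLECTION `ω ↦ ωᶜ`, `p ↦ σ ∘ p` [GrimmettPercolation1999, §11.2] (`sahiE3_eq_sahiE3_preimage_compl`): the reflected hitting event is the
  decreasing event `D_S = {ω | ¬ (S ⊆ ω)}` ("some coordinate of `S` absent" = NOT the cylinder), so
  `prodBernoulli_sahiE3_notAllMem_nonneg`: `0 ≤ E₃(D_A, D_B, D_C)` under every `prodBernoulli p` — the decreasing form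
  [Kahn2022, Conj. 5 is stated for increasing events; LiebSahi2021, footnote 2];
* SPECIALISATION to Mathlib's `setBer(u, p)` (`prodBernoulli_indicator_holds`) and to bond percolation `P_p = bondPercolation G p =
  setBer(E(G), p)` on ANY graph (finite or infinite): for finite edge sets `F₁, F₂, F₃`,
  `sahiE3_bondPercolation_someOpen_nonneg` — `0 ≤ E₃({some edge of F₁ open}, {some edge of F₂ open}, {some edge of F₃ open})`, and
  `sahiE3_bondPercolation_someClosed_nonneg` — `0 ≤ E₃({some edge of F₁ closed}, …)`; compare the tree's cylinder rows
  `SahiInfiniteVolume.sahiE3_bondPercolation_openEdges_nonneg` ("all edges of F open", one slot) [Sahi2008, Thm. 2].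
[cite: Kahn2022, Conj. 5 (arXiv p. 3); GrimmettPercolation1999, §1.3 and §11.2; Sahi2008, Conj. 5]
-/

noncomputable section

namespace Summit.CriticalPhenomena.PercolationContinuityZ3.Theorems

namespace SahiHitting

open MeasureTheory ProbabilityTheory Literature.Probability.LatticeModels Literature.Probability.Percolation

variable {ι : Type*}

/-- The reflection of "some coordinate of `S` absent" is the hitting event of `S`. [folklore] -/
theorem preimage_compl_notAllMem (S : Finset ι) :
    compl ⁻¹' {ω : Set ι | ¬ ((↑S : Set ι) ⊆ ω)} = {ω : Set ι | ∃ i ∈ S, i ∈ ω} := by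
  ext ω
  simp only [Set.mem_preimage, Set.mem_setOf_eq, Set.subset_def, Finset.mem_coe, Set.mem_compl_iff, not_forall,
    not_not, exists_prop]

/-- "Some coordinate of `S` absent" is measurable. [folklore] -/
theorem measurableSet_notAllMem (S : Finset ι) : MeasurableSet {ω : Set ι | ¬ ((↑S : Set ι) ⊆ ω)} := by
  have e : {ω : Set ι | ¬ ((↑S : Set ι) ⊆ ω)} = {ω : Set ι | (↑S : Set ι) ⊆ ω}ᶜ := by
    ext ω; simp only [Set.mem_setOf_eq, Set.mem_compl_iff]
  rw [e]
  exact (SahiInfiniteVolume.measurableSet_supset_finset S).compl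

/-- **Decreasing form: `0 ≤ E₃` for three events "some coordinate of `S` absent"** (`D_S = {ω | ¬ S ⊆ ω}`, the complements
of cylinders) under every product measure `prodBernoulli p`, any index type, any `p`, finite `A, B, C`.
[this work; cite: Kahn2022, Conj. 5 (arXiv p. 3); GrimmettPercolation1999, §11.2] -/
theorem prodBernoulli_sahiE3_notAllMem_nonneg (p : ι → unitInterval) (A B C : Finset ι) :
    0 ≤ sahiE3 (prodBernoulli p)
      {ω : Set ι | ¬ ((↑A : Set ι) ⊆ ω)} {ω : Set ι | ¬ ((↑B : Set ι) ⊆ ω)} {ω : Set ι | ¬ ((↑C : Set ι) ⊆ ω)} := by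
  rw [sahiE3_eq_sahiE3_preimage_compl p (measurableSet_notAllMem A) (measurableSet_notAllMem B)
    (measurableSet_notAllMem C), preimage_compl_notAllMem, preimage_compl_notAllMem, preimage_compl_notAllMem]
  exact prodBernoulli_sahiE3_hit_nonneg _ A B C

/-- **`setBer(u, p)` form**: three hitting events under Mathlib's homogeneous product measure on a set `u` of coordinates
(coordinates off `u` are absent a.s.). [this work; cite: Grimmett1999, §1.3] -/
theorem setBernoulli_sahiE3_hit_nonneg (u : Set ι) (p : unitInterval) (A B C : Finset ι) :
    0 ≤ sahiE3 setBer(u, p) {ω : Set ι | ∃ i ∈ A, i ∈ ω} {ω : Set ι | ∃ i ∈ B, i ∈ ω} {ω : Set ι | ∃ i ∈ C, i ∈ ω} := by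
  classical
  rw [← prodBernoulli_indicator_holds u p]
  exact prodBernoulli_sahiE3_hit_nonneg _ A B C

/-- **`setBer(u, p)` form, decreasing**: three events "some coordinate of `S` absent". [this work; cite: Grimmett1999, §1.3] -/
theorem setBernoulli_sahiE3_notAllMem_nonneg (u : Set ι) (p : unitInterval) (A B C : Finset ι) :
    0 ≤ sahiE3 setBer(u, p)
      {ω : Set ι | ¬ ((↑A : Set ι) ⊆ ω)} {ω : Set ι | ¬ ((↑B : Set ι) ⊆ ω)} {ω : Set ι | ¬ ((↑C : Set ι) ⊆ ω)} := by
  classical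
  rw [← prodBernoulli_indicator_holds u p]
  exact prodBernoulli_sahiE3_notAllMem_nonneg _ A B C

variable {V : Type*}

/-- **Bond percolation on ANY graph: `0 ≤ E₃({some edge of F₁ open}, {some edge of F₂ open}, {some edge of F₃ open})`** for
finite edge sets `F₁, F₂, F₃` under `P_p = bondPercolation G p`. [this work; cite: Kahn2022, Conj. 5 (arXiv p. 3); Grimmett1999, §1.3] -/
theorem sahiE3_bondPercolation_someOpen_nonneg (G : SimpleGraph V) (p : unitInterval) (F₁ F₂ F₃ : Finset (Sym2 V)) :
    0 ≤ sahiE3 (bondPercolation G p) {ω : BondConfig V | ∃ e ∈ F₁, e ∈ ω} {ω : BondConfig V | ∃ e ∈ F₂, e ∈ ω}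
      {ω : BondConfig V | ∃ e ∈ F₃, e ∈ ω} := by
  unfold bondPercolation
  exact setBernoulli_sahiE3_hit_nonneg _ p F₁ F₂ F₃

/-- **Bond percolation on ANY graph, decreasing form: `0 ≤ E₃({some edge of F₁ closed}, {some edge of F₂ closed},
{some edge of F₃ closed})`** for finite edge sets under `P_p`. [this work; cite: Kahn2022, Conj. 5 (arXiv p. 3); GrimmettPercolation1999, §11.2] -/
theorem sahiE3_bondPercolation_someClosed_nonneg (G : SimpleGraph V) (p : unitInterval) (F₁ F₂ F₃ : Finset (Sym2 V)) :
    0 ≤ sahiE3 (bondPercolation G p) {ω : BondConfig V | ¬ ((↑F₁ : Set (Sym2 V)) ⊆ ω)}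
      {ω : BondConfig V | ¬ ((↑F₂ : Set (Sym2 V)) ⊆ ω)} {ω : BondConfig V | ¬ ((↑F₃ : Set (Sym2 V)) ⊆ ω)} := by
  unfold bondPercolation
  exact setBernoulli_sahiE3_notAllMem_nonneg _ p F₁ F₂ F₃

end SahiHitting

end Summit.CriticalPhenomena.PercolationContinuityZ3.Theorems
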